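/-
Copyright: the b2b-balaban T⁴-continuum CRUX team, row NE7b OWNER lineage `t4-ne7b-p1` (gen 134). Project licence.
-/
import Summits.QuantumFields.BalabanUV.T4Continuum.Spine.NE7b.SupPolymerLocalExpansion
import Summits.QuantumFields.BalabanUV.T4Continuum.Spine.NE7b.SupStepReMayer

/-!
# THE POLYMER-LOCAL PARTITION FUNCTION IS A MAYER PRODUCT OVER THE CONNECTED CELL SETS OF ITS SUPPORT, WITH FACTORS OF SMALL PINNED NORM — the
# measure-level END of SCOPING-d6's loop: for set factors `g_X` on a family `𝒳` of `R`-connected cell sets over a finite-range dependent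
# reference process (`R` symmetric with `≤ Δ` neighbours) whose RESUMMED activity `z = ⋃_*M` has a sup letter `‖z(Y)‖ ≤ ε₀^{#Y}` (discharged for
# the Gaussian road by (355)'s `shifted_pushforward_letters`, or linearly in the factor letter by (357)), and `0 ≤ τ₂` with
# `(Δ+1)²ε₀e^{1+τ₂} ≤ 1∕2`, `η := (Δ+1)·2ε₀e^{1+τ₂} ≤ 1`:
#   `Z(𝒳) = ∫∏_{X∈𝒳}(1 + g_X)dμ = ∏_{Y ∈ 𝒫(⋃𝒳)} (1 + f⁺_Y)`,   `f⁺_Y = e^{K⁺(Y)} − 1`,   `K⁺(Y) = Σ_{𝒞 ⊆ L, ⋃𝒞 = Y}Φ^T(𝒞)`,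
#   `Σ_{Y ∈ 𝒫(⋃𝒳) touching {q}}‖K⁺(Y)‖e^{τ₂#Y} ≤ (Δ+1)η`   and, when `(Δ+1)η ≤ 1`,   `Σ_{Y touching {q}}‖f⁺_Y‖e^{τ₂#Y} ≤ 2(Δ+1)η`:
# polymer-local Mayer data in ⟹ polymer-local Mayer data out, indexed by connected cell sets, measured in the pinned Kotecký–Preiss norm, every
# constant explicit ((352)∕(353)∕(354)∕(358) BY NAME; row NE7b, node U5c; [folklore])

Cell `pub-balaban`, sub-cell `t4`, spine estimate NE7b (`T4WeightBudget.RelWeightBound`; the cell's OWN estimate — NOT PRINTED in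
[Bałaban 1983–89], NOT PROVED).  Crux-route work under `Spine/NE7b/` by the row OWNER (`t4-ne7b-p1` gen 134, file (361)) under FREEZE
(0)'s crux-prover clause, on `g134/records/SCOPING-d6-iteration.md` DECISION (1)∕(2); NOTHING of Bałaban's is named as a Lean object, valued or asserted;
no `T4Continuum/Support` leaf typed; no `def`, no notation; zero `sorry`.  Imports (BY NAME): the OWNER's (353) `…SupPolymerLocalExpansion`
(`setPertZ_eq_resummedGas`, `pushforward_eq_zero_of_not_rconn`), (358) `…SupStepReMayer` (`outputTouchNorm_le_of_supLetter`, `touchNorm_expSubOne_le`,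
`exp_sum_eq_prod_one_add`) and through them (352) (`exp_polymerLogZ`), (354) (`polymerLogZ_eq_sum_support`), (349) (`image_biUnion_subset_rconn`);
the tree's `pertZ`, `cellActivity`, `pushforwardActivity`, `rconnSubsets`, `mem_rconnSubsets`, `truncatedWeight`, `Touches`, `GeomInc`, `IsRConnected`.

WHAT IS PROVED ([folklore]; `z := ⋃_*M` on `L := (𝒫^{Touches R}(𝒳)).image ⋃`, `K⁺(Y) := Σ_{𝒞 ∈ L.powerset, ⋃𝒞 = Y}Φ^T(𝒞)`, all displayed):
* §1 smallness bookkeeping: `smallness_e_of_decay` (`(Δ+1)²ε₀e^{1+τ₂} ≤ 1∕2 ⟹ e·ε₀·(Δ+1)² ≤ 1∕2`), `image_nonempty` (polymers of `L` are nonempty);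
* §2 **`setPertZ_eq_prod_nextFactors`** (`Z(𝒳) = ∏_{Y∈𝒫(⋃𝒳)}(1 + (e^{K⁺(Y)} − 1))`, probability reference process with cell σ-algebras, set factors
  measurable in their cells with integrable products);
* §3 **`outputTouchNorm_le`** (`Σ_{Y∈𝒫(⋃𝒳) touching {q}}‖K⁺(Y)‖e^{τ₂#Y} ≤ (Δ+1)·((Δ+1)·2ε₀e^{1+τ₂})`, activity letter only),
  **`nextFactors_touchNorm_le`** (`Σ_{Y∈𝒫(⋃𝒳) touching {q}}‖e^{K⁺(Y)} − 1‖e^{τ₂#Y} ≤ 2(Δ+1)·((Δ+1)·2ε₀e^{1+τ₂})` when `(Δ+1)²·2ε₀e^{1+τ₂} ≤ 1`); §4 toy.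

HONEST (what this is NOT).  Measure level at fixed factors (the external field is inside `g`); the next step needs these factors as FUNCTIONS of the
next fluctuation field with the (355)-type letters (sup on small fields + large-field excision, SCOPING-d6 (L3)) — not typed; the weight bookkeeping
`1+τ₂ ↦ τ₂` and its regeneration by blocking are (356)∕(359)∕(360); scalar skeleton ((A3), NC-NE7b-α UNRULED); nothing of Bałaban's asserted.
BY-NAME EFFECT ON THE WALL: NONE.  NE7b NOT PRINTED ∕ NOT PROVED; spine PROVED 0∕9; rung (B)+1 — the programme's measures remain FINITE-torus
statements; NOT the mass gap, NOT Clay.  HONEST DEPENDENCY: continuum YM on T⁴ ⇐ BetaPertH ∧ nine spine estimates (0∕9 proved); BetaPertH ⇐ (D1) ∧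
(D4) ∧ CAP+tail; G-an2-4 gates asym, D1 and NE2∕3∕4.
-/

set_option autoImplicit false

noncomputable section

namespace Summit.QuantumFields.BalabanUV.T4Continuum.NE7b.SupPolymerLocalNextFactors

open MeasureTheory ProbabilityTheory Finset Real
open scoped BigOperators
open Literature.Probability.LatticeModels
open SupPolymerLocalExpansion (setPertZ_eq_resummedGas pushforward_eq_zero_of_not_rconn)
open SupPolymerLocalResummation (image_biUnion_subset_rconn)
open SupClusterSupportRegrouping (polymerLogZ_eq_sum_support)
open SupStepReMayer (outputTouchNorm_le_of_supLetter touchNorm_expSubOne_le exp_sum_eq_prod_one_add)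

variable {V : Type*} [DecidableEq V] {R : V → V → Prop} [DecidableRel R] {nbr : V → Finset V} {Δ : ℕ} {ε₀ τ₂ : ℝ}

/-! ## §1. Smallness bookkeeping -/

omit [DecidableEq V] [DecidableRel R] in
/-- `0 ≤ ε₀`, `0 ≤ τ₂`, `(Δ+1)²·ε₀e^{1+τ₂} ≤ 1∕2 ⟹ e·ε₀·(Δ+1)² ≤ 1∕2` (the plain KP smallness of (352)). [folklore] -/
theorem smallness_e_of_decay (hε : 0 ≤ ε₀) (hτ : 0 ≤ τ₂) (hsmall : ((Δ : ℝ) + 1) ^ 2 * (ε₀ * Real.exp (1 + τ₂)) ≤ 1 / 2) :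
    Real.exp 1 * ε₀ * ((Δ : ℝ) + 1) ^ 2 ≤ 1 / 2 := by
  have h1 : Real.exp 1 ≤ Real.exp (1 + τ₂) := exp_le_exp.2 (by linarith)
  have h2 : 0 ≤ ε₀ * ((Δ : ℝ) + 1) ^ 2 := by positivity
  nlinarith

/-- The polymers of the image family are nonempty (members of `𝒳` `R`-connected). [folklore] -/
theorem image_nonempty (𝒳 : Finset (Finset V)) (hconn : ∀ X ∈ 𝒳, IsRConnected R X) :
    ∀ Y ∈ (rconnSubsets (Touches R) 𝒳).image (fun 𝒜 : Finset (Finset V) => 𝒜.biUnion id), Y.Nonempty := fun _ hY =>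
  (mem_rconnSubsets.1 (image_biUnion_subset_rconn 𝒳 hconn hY)).2.1

/-! ## §2. The partition function is a Mayer product over the connected cell sets of the support -/

section Measure

variable {Ω : Type*} {mΩ : MeasurableSpace Ω} {μ : Measure Ω} {𝓕 : V → MeasurableSpace Ω} {g : Finset V → Ω → ℂ}

/-- **`Z(𝒳) = ∏_{Y ∈ 𝒫(⋃𝒳)}(1 + f⁺_Y)`, `f⁺_Y = e^{K⁺(Y)} − 1`.**  `R` symmetric with `≤ Δ` neighbours; a probability reference process with cell σ-algebras
`𝓕_p ≤ mΩ` independent across non-touching cell sets; set factors measurable in `⨆_{p∈X}𝓕_p` with integrable products; members of `𝒳` `R`-connected;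
the resummed activity has a sup letter `ε₀ ≥ 0` with `eε₀(Δ+1)² ≤ 1∕2` ⟹ the displayed product formula. [folklore] -/
theorem setPertZ_eq_prod_nextFactors [IsProbabilityMeasure μ] (hR : ∀ x y, R x y → R y x) (hΔ : ∀ x, (nbr x).card ≤ Δ)
    (hnbr : ∀ x y, R x y → y ∈ nbr x) (hle : ∀ p, 𝓕 p ≤ mΩ)
    (hindep : ∀ K₁ K₂ : Finset V, ¬ Touches R K₁ K₂ → Indep (⨆ p ∈ K₁, 𝓕 p) (⨆ p ∈ K₂, 𝓕 p) μ)
    (hmeas : ∀ X, Measurable[⨆ p ∈ X, 𝓕 p] (g X)) (hint : ∀ 𝒜 : Finset (Finset V), Integrable (fun ω => ∏ X ∈ 𝒜, g X ω) μ)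
    (𝒳 : Finset (Finset V)) (hconn : ∀ X ∈ 𝒳, IsRConnected R X) (hε : 0 ≤ ε₀)
    (hz : ∀ Y, ‖pushforwardActivity (fun 𝒜 : Finset (Finset V) => 𝒜.biUnion id) (cellActivity μ g) (rconnSubsets (Touches R) 𝒳) Y‖ ≤ ε₀ ^ Y.card)
    (hsmall : Real.exp 1 * ε₀ * ((Δ : ℝ) + 1) ^ 2 ≤ 1 / 2) :
    pertZ μ g 𝒳 = ∏ Y ∈ rconnSubsets R (𝒳.biUnion id), (1 + (Complex.exp
      (∑ 𝒞 ∈ ((rconnSubsets (Touches R) 𝒳).image fun 𝒜 => 𝒜.biUnion id).powerset with 𝒞.biUnion id = Y,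
        truncatedWeight (GeomInc R) (pushforwardActivity (fun 𝒜 : Finset (Finset V) => 𝒜.biUnion id) (cellActivity μ g)
          (rconnSubsets (Touches R) 𝒳)) 𝒞) - 1)) := by
  haveI : Std.Symm R := ⟨hR⟩
  have hz0 := pushforward_eq_zero_of_not_rconn 𝒳 hconn (cellActivity μ g)
  rw [← exp_sum_eq_prod_one_add, ← polymerLogZ_eq_sum_support hR hΔ hnbr hz0 hz hε hsmall (image_biUnion_subset_rconn 𝒳 hconn),
    SupPolymerActivityExpansion.exp_polymerLogZ hΔ hnbr hz0 hz hε hsmall, setPertZ_eq_resummedGas hR hle hindep hmeas hint 𝒳 hconn]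

end Measure

/-! ## §3. The pinned norms of the output terms and of the next factors -/

section Norms

variable {Ω : Type*} {mΩ : MeasurableSpace Ω} {μ : Measure Ω} {g : Finset V → Ω → ℂ}

/-- **THE OUTPUT TERMS IN THE PINNED NORM**: `R` symmetric with `≤ Δ` neighbours, members of `𝒳` `R`-connected, the resummed activity with sup letter
`ε₀ ≥ 0`, `0 ≤ τ₂`, `(Δ+1)²ε₀e^{1+τ₂} ≤ 1∕2`, `(Δ+1)·2ε₀e^{1+τ₂} ≤ 1` ⟹ for every cell `q`,
`Σ_{Y∈𝒫(⋃𝒳) touching {q}}‖K⁺(Y)‖e^{τ₂#Y} ≤ (Δ+1)·((Δ+1)·2ε₀e^{1+τ₂})`. [folklore] -/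
theorem outputTouchNorm_le (hR : ∀ x y, R x y → R y x) (hΔ : ∀ x, (nbr x).card ≤ Δ) (hnbr : ∀ x y, R x y → y ∈ nbr x)
    (𝒳 : Finset (Finset V)) (hconn : ∀ X ∈ 𝒳, IsRConnected R X) (hε : 0 ≤ ε₀) (hτ : 0 ≤ τ₂)
    (hz : ∀ Y, ‖pushforwardActivity (fun 𝒜 : Finset (Finset V) => 𝒜.biUnion id) (cellActivity μ g) (rconnSubsets (Touches R) 𝒳) Y‖ ≤ ε₀ ^ Y.card)
    (hsmall : ((Δ : ℝ) + 1) ^ 2 * (ε₀ * Real.exp (1 + τ₂)) ≤ 1 / 2) (hη : ((Δ : ℝ) + 1) * (2 * (ε₀ * Real.exp (1 + τ₂))) ≤ 1) (q : V) :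
    ∑ Y ∈ rconnSubsets R (𝒳.biUnion id) with Touches R Y {q},
        ‖∑ 𝒞 ∈ ((rconnSubsets (Touches R) 𝒳).image fun 𝒜 => 𝒜.biUnion id).powerset with 𝒞.biUnion id = Y,
          truncatedWeight (GeomInc R) (pushforwardActivity (fun 𝒜 : Finset (Finset V) => 𝒜.biUnion id) (cellActivity μ g)
            (rconnSubsets (Touches R) 𝒳)) 𝒞‖ * Real.exp (τ₂ * Y.card) ≤
      ((Δ : ℝ) + 1) * (((Δ : ℝ) + 1) * (2 * (ε₀ * Real.exp (1 + τ₂)))) :=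
  outputTouchNorm_le_of_supLetter hR hΔ hnbr (pushforward_eq_zero_of_not_rconn 𝒳 hconn _) hz hε hτ hsmall hη (image_nonempty 𝒳 hconn) _ q

/-- **THE NEXT MAYER FACTORS IN THE PINNED NORM**: in addition `(Δ+1)·((Δ+1)·2ε₀e^{1+τ₂}) ≤ 1` ⟹ for every cell `q`,
`Σ_{Y∈𝒫(⋃𝒳) touching {q}}‖e^{K⁺(Y)} − 1‖e^{τ₂#Y} ≤ 2(Δ+1)·((Δ+1)·2ε₀e^{1+τ₂})`. [folklore] -/
theorem nextFactors_touchNorm_le (hR : ∀ x y, R x y → R y x) (hΔ : ∀ x, (nbr x).card ≤ Δ) (hnbr : ∀ x y, R x y → y ∈ nbr x)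
    (𝒳 : Finset (Finset V)) (hconn : ∀ X ∈ 𝒳, IsRConnected R X) (hε : 0 ≤ ε₀) (hτ : 0 ≤ τ₂)
    (hz : ∀ Y, ‖pushforwardActivity (fun 𝒜 : Finset (Finset V) => 𝒜.biUnion id) (cellActivity μ g) (rconnSubsets (Touches R) 𝒳) Y‖ ≤ ε₀ ^ Y.card)
    (hsmall : ((Δ : ℝ) + 1) ^ 2 * (ε₀ * Real.exp (1 + τ₂)) ≤ 1 / 2)
    (hη1 : ((Δ : ℝ) + 1) * (((Δ : ℝ) + 1) * (2 * (ε₀ * Real.exp (1 + τ₂)))) ≤ 1) (q : V) :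
    ∑ Y ∈ rconnSubsets R (𝒳.biUnion id) with Touches R Y {q},
        ‖Complex.exp (∑ 𝒞 ∈ ((rconnSubsets (Touches R) 𝒳).image fun 𝒜 => 𝒜.biUnion id).powerset with 𝒞.biUnion id = Y,
          truncatedWeight (GeomInc R) (pushforwardActivity (fun 𝒜 : Finset (Finset V) => 𝒜.biUnion id) (cellActivity μ g)
            (rconnSubsets (Touches R) 𝒳)) 𝒞) - 1‖ * Real.exp (τ₂ * (Y.card : ℝ)) ≤
      2 * (((Δ : ℝ) + 1) * (((Δ : ℝ) + 1) * (2 * (ε₀ * Real.exp (1 + τ₂))))) := by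
  have hΔ1 : (1 : ℝ) ≤ (Δ : ℝ) + 1 := by
    have : (0 : ℝ) ≤ Δ := Nat.cast_nonneg Δ
    linarith
  have hη : ((Δ : ℝ) + 1) * (2 * (ε₀ * Real.exp (1 + τ₂))) ≤ 1 :=
    le_trans (le_mul_of_one_le_left (by positivity) hΔ1) hη1
  refine touchNorm_expSubOne_le (R := R) hτ (fun Y hY => (mem_rconnSubsets.1 hY).2.1) (fun q' => ?_) hη1 q
  exact outputTouchNorm_le hR hΔ hnbr 𝒳 hconn hε hτ hz hsmall hη q'

end Norms

/-! ## §4. Toy -/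

omit [DecidableEq V] [DecidableRel R] in
/-- Toy (§1): with `τ₂ = 0` the decay smallness `(Δ+1)²ε₀e ≤ 1∕2` is the plain one. -/
example (hε : 0 ≤ ε₀) (hsmall : ((Δ : ℝ) + 1) ^ 2 * (ε₀ * Real.exp (1 + 0)) ≤ 1 / 2) : Real.exp 1 * ε₀ * ((Δ : ℝ) + 1) ^ 2 ≤ 1 / 2 :=
  smallness_e_of_decay hε le_rfl hsmall

end Summit.QuantumFields.BalabanUV.T4Continuum.NE7b.SupPolymerLocalNextFactors
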